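import Mathlib
import HarnessLib
import Summits.PneNP.PneNP.Theorems.FoolingMeasure.Negative.FoolingMeasureFalseOfHalfSparseCore

/-!
# Crux `FoolingMeasure` (stmt-PneNP-19727): ONE-SIDED RECTANGLES — both sides of every near-balanced cut must be
# 3-colourable (a refuted weakening)

Lead prover pnp-aea-p1 g2 (2026-08-27), route `AeaCutRectangles`.  The two cheapest cut rectangles inside
NON-3-COL over a cut `B` are the ONE-SIDED ones: {Alice parts that are non-3-colourable by themselves} × {all Bob
parts} and {all Alice parts} × {Bob parts that are non-3-colourable by themselves} (the duties `Φ = ∅` and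
`Φ = everything` of `AeaCutRectanglesDutyRectangles`).  Hence X1
(`Summit.PneNP.PneNP.Theses.AeaCutRectangles.FoolingMeasure`) forces, at every near-balanced cut `B`,
`μ{G : G ∖ G[B] non-3-colourable} ≤ δ` (`aliceAlone_le_of_rectClause`, the case `H = ∅` of the Bob-superset
rectangles of `FoolingMeasure.Negative`) and `μ{G : G[B] non-3-colourable} ≤ δ` (`bobAlone_le_of_rectClause`).
Union bound over the `≤ 2^n` cuts:

* **`foolingMeasure_false_for_nonColourableSide`** — X1 restricted to measures each of whose support graphs has
  SOME near-balanced cut (in X1's window) one of whose two sides — the edges inside `B`, or the edges meeting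
  `Fin n ∖ B` — is already non-3-colourable, is FALSE (at `C = 2`: `2·2^n·n^{-n/2}·2^{-2n} < 1`).

So a typical X1 support graph has BOTH sides 3-colourable at EVERY near-balanced cut (requirement R3 of the
analysis `Cruxes/FoolingMeasure/Lines/duty-analysis-g2.md`); for a 4-critical graph this is automatic, for
random-like graphs of average degree `≳ 6` it fails at the minimum bisection (densest half non-3-colourable) —
one jaw of the "no-window" squeeze, the other being `AeaCutRectanglesNoSparseSupports.foolingMeasure_false_for_sparseHalf`
/ `AeaCutRectanglesSparseCores.foolingMeasure_false_for_fewEdges`.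

HONEST FRAMING: elementary bookkeeping; FRONTIER material for a rung of Fagin's complement ladder (NON-3-COL vs
ESO(∀∃∀)); restricted-model witness — nothing here bears on P vs NP.
-/

set_option linter.dupNamespace false
set_option autoImplicit false

namespace Summit.PneNP.PneNP.Theorems.AeaCutRectanglesOneSided

open Finset
open Summit.PneNP.PneNP.Theorems.AeaCutRectanglesDutyRectangles
open Summit.PneNP.PneNP.Theorems.AeaCutRectanglesSparseWitnesses
open Summit.PneNP.PneNP.Theorems.FoolingMeasure.Negative

section General

variable {V : Type*} [Fintype V] [DecidableEq V]

/-- **Alice alone.**  X1's clause at `B` with bound `δ` forces `μ(T) ≤ δ` for every family `T` of graphs carrying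
mass only if their outside part `G ∖ G[B]` is non-3-colourable (the Bob-superset rectangle of `H = ∅`). -/
theorem aliceAlone_le_of_rectClause (μ : Finset (Sym2 V) → ℝ) (hμ : ∀ S, 0 ≤ μ S)
    (hs : ∀ S, μ S ≠ 0 → (∀ e ∈ S, ¬ e.IsDiag) ∧
      ¬ (SimpleGraph.fromEdgeSet (S : Set (Sym2 V))).Colorable 3)
    {B : Finset V} {δ : ℝ}
    (hclause : ∀ 𝓐 𝓑 : Finset (Finset (Sym2 V)),
      (∀ α ∈ 𝓐, ∀ e ∈ α, ¬ e.IsDiag ∧ ∃ v ∈ e, v ∉ B) →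
      (∀ β ∈ 𝓑, ∀ e ∈ β, ¬ e.IsDiag ∧ ∀ v ∈ e, v ∈ B) →
      (∀ α ∈ 𝓐, ∀ β ∈ 𝓑,
        ¬ (SimpleGraph.fromEdgeSet ((α ∪ β : Finset (Sym2 V)) : Set (Sym2 V))).Colorable 3) →
      ∑ q ∈ 𝓐 ×ˢ 𝓑, μ (q.1 ∪ q.2) ≤ δ)
    (T : Finset (Finset (Sym2 V)))
    (hT : ∀ G ∈ T, μ G ≠ 0 →
      ¬ (SimpleGraph.fromEdgeSet ((aliceSide B G : Finset (Sym2 V)) : Set (Sym2 V))).Colorable 3) :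
    ∑ G ∈ T, μ G ≤ δ := by
  refine bobSupset_le_of_rectClause μ hμ hs hclause ∅ T (fun G hG hGμ => ⟨empty_subset _, ?_⟩)
  rw [union_empty]
  exact hT G hG hGμ

/-- **The Bob-alone rectangle.**  For `μ ≥ 0` supported on loopless non-3-colourable edge sets and any family
`T` of graphs carrying mass only if their inside part `G[B]` is non-3-colourable, {outside parts of `T`} ×
{inside parts of `T`} is a cut rectangle over `B` inside NON-3-COL of mass `≥ μ(T)`. -/
theorem bobAlone_sum_le_rect (μ : Finset (Sym2 V) → ℝ) (hμ : ∀ S, 0 ≤ μ S)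
    (hs : ∀ S, μ S ≠ 0 → (∀ e ∈ S, ¬ e.IsDiag) ∧
      ¬ (SimpleGraph.fromEdgeSet (S : Set (Sym2 V))).Colorable 3)
    (B : Finset V) (T : Finset (Finset (Sym2 V)))
    (hT : ∀ G ∈ T, μ G ≠ 0 →
      ¬ (SimpleGraph.fromEdgeSet ((bobSide B G : Finset (Sym2 V)) : Set (Sym2 V))).Colorable 3) :
    ∃ 𝓐 𝓑 : Finset (Finset (Sym2 V)),
      (∀ α ∈ 𝓐, ∀ e ∈ α, ¬ e.IsDiag ∧ ∃ v ∈ e, v ∉ B) ∧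
      (∀ β ∈ 𝓑, ∀ e ∈ β, ¬ e.IsDiag ∧ ∀ v ∈ e, v ∈ B) ∧
      (∀ α ∈ 𝓐, ∀ β ∈ 𝓑,
        ¬ (SimpleGraph.fromEdgeSet ((α ∪ β : Finset (Sym2 V)) : Set (Sym2 V))).Colorable 3) ∧
      ∑ G ∈ T, μ G ≤ ∑ q ∈ 𝓐 ×ˢ 𝓑, μ (q.1 ∪ q.2) := by
  classical
  set F : Finset (Finset (Sym2 V)) := T.filter (fun G => μ G ≠ 0) with hF
  refine ⟨F.image (aliceSide B), F.image (bobSide B), ?_, ?_, ?_, ?_⟩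
  · intro α hα e he
    obtain ⟨G, hG, rfl⟩ := mem_image.1 hα
    obtain ⟨heG, hout⟩ := mem_aliceSide.1 he
    exact ⟨(hs G (mem_filter.1 hG).2).1 e heG, hout⟩
  · intro β hβ e he
    obtain ⟨G, hG, rfl⟩ := mem_image.1 hβ
    obtain ⟨heG, hin⟩ := mem_bobSide.1 he
    exact ⟨(hs G (mem_filter.1 hG).2).1 e heG, hin⟩
  · intro α hα β hβ
    obtain ⟨G', hG', rfl⟩ := mem_image.1 hβ
    obtain ⟨hG'T, hG'μ⟩ := mem_filter.1 hG'
    exact not_colorable_of_subset subset_union_right (hT G' hG'T hG'μ)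
  · have hinj : ∀ G ∈ F, ∀ G' ∈ F,
        (aliceSide B G, bobSide B G) = (aliceSide B G', bobSide B G') → G = G' := by
      intro G _ G' _ h
      have h1 : aliceSide B G = aliceSide B G' := congrArg Prod.fst h
      have h2 : bobSide B G = bobSide B G' := congrArg Prod.snd h
      rw [← aliceSide_union_bobSide B G, ← aliceSide_union_bobSide B G', h1, h2]
    calc ∑ G ∈ T, μ G = ∑ G ∈ F, μ G := (sum_filter_ne_zero T).symm
      _ = ∑ G ∈ F, μ ((aliceSide B G, bobSide B G).1 ∪ (aliceSide B G, bobSide B G).2) := by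
          refine sum_congr rfl fun G _ => ?_
          show μ G = μ (aliceSide B G ∪ bobSide B G)
          rw [aliceSide_union_bobSide]
      _ = ∑ q ∈ F.image (fun G => (aliceSide B G, bobSide B G)), μ (q.1 ∪ q.2) := by
          rw [sum_image hinj]
      _ ≤ ∑ q ∈ F.image (aliceSide B) ×ˢ F.image (bobSide B), μ (q.1 ∪ q.2) := by
          apply sum_le_sum_of_subset_of_nonneg
          · intro q hq
            obtain ⟨G, hG, rfl⟩ := mem_image.1 hq
            exact mem_product.2 ⟨mem_image_of_mem _ hG, mem_image_of_mem _ hG⟩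
          · intro q _ _
            exact hμ _

/-- **Bob alone.**  X1's clause at `B` with bound `δ` forces `μ(T) ≤ δ` for every family `T` of graphs carrying
mass only if their inside part `G[B]` is non-3-colourable. -/
theorem bobAlone_le_of_rectClause (μ : Finset (Sym2 V) → ℝ) (hμ : ∀ S, 0 ≤ μ S)
    (hs : ∀ S, μ S ≠ 0 → (∀ e ∈ S, ¬ e.IsDiag) ∧
      ¬ (SimpleGraph.fromEdgeSet (S : Set (Sym2 V))).Colorable 3)
    {B : Finset V} {δ : ℝ}
    (hclause : ∀ 𝓐 𝓑 : Finset (Finset (Sym2 V)),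
      (∀ α ∈ 𝓐, ∀ e ∈ α, ¬ e.IsDiag ∧ ∃ v ∈ e, v ∉ B) →
      (∀ β ∈ 𝓑, ∀ e ∈ β, ¬ e.IsDiag ∧ ∀ v ∈ e, v ∈ B) →
      (∀ α ∈ 𝓐, ∀ β ∈ 𝓑,
        ¬ (SimpleGraph.fromEdgeSet ((α ∪ β : Finset (Sym2 V)) : Set (Sym2 V))).Colorable 3) →
      ∑ q ∈ 𝓐 ×ˢ 𝓑, μ (q.1 ∪ q.2) ≤ δ)
    (T : Finset (Finset (Sym2 V)))
    (hT : ∀ G ∈ T, μ G ≠ 0 →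
      ¬ (SimpleGraph.fromEdgeSet ((bobSide B G : Finset (Sym2 V)) : Set (Sym2 V))).Colorable 3) :
    ∑ G ∈ T, μ G ≤ δ := by
  obtain ⟨𝓐, 𝓑, h𝓐, h𝓑, hN, hle⟩ := bobAlone_sum_le_rect μ hμ hs B T hT
  exact hle.trans (hclause 𝓐 𝓑 h𝓐 h𝓑 hN)

/-- **One-sided supports are cheap.**  If every support graph of `μ` has a cut in the window `W` one of whose
two sides is non-3-colourable, and X1's clause holds with bound `δ ≥ 0` at every cut of the window, then the
TOTAL mass is at most `2^{|V|} · (2δ)`. -/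
theorem total_le_of_oneSided (μ : Finset (Sym2 V) → ℝ) (hμ : ∀ S, 0 ≤ μ S)
    (hs : ∀ S, μ S ≠ 0 → (∀ e ∈ S, ¬ e.IsDiag) ∧
      ¬ (SimpleGraph.fromEdgeSet (S : Set (Sym2 V))).Colorable 3)
    (W : Finset V → Prop) [DecidablePred W] {δ : ℝ} (hδ : 0 ≤ δ)
    (hclause : ∀ B, W B → ∀ 𝓐 𝓑 : Finset (Finset (Sym2 V)),
      (∀ α ∈ 𝓐, ∀ e ∈ α, ¬ e.IsDiag ∧ ∃ v ∈ e, v ∉ B) →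
      (∀ β ∈ 𝓑, ∀ e ∈ β, ¬ e.IsDiag ∧ ∀ v ∈ e, v ∈ B) →
      (∀ α ∈ 𝓐, ∀ β ∈ 𝓑,
        ¬ (SimpleGraph.fromEdgeSet ((α ∪ β : Finset (Sym2 V)) : Set (Sym2 V))).Colorable 3) →
      ∑ q ∈ 𝓐 ×ˢ 𝓑, μ (q.1 ∪ q.2) ≤ δ)
    (hrestr : ∀ S, μ S ≠ 0 → ∃ B, W B ∧
      (¬ (SimpleGraph.fromEdgeSet ((bobSide B S : Finset (Sym2 V)) : Set (Sym2 V))).Colorable 3 ∨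
       ¬ (SimpleGraph.fromEdgeSet ((aliceSide B S : Finset (Sym2 V)) : Set (Sym2 V))).Colorable 3)) :
    ∑ S, μ S ≤ ((2 ^ Fintype.card V : ℕ) : ℝ) * (2 * δ) := by
  classical
  set Wset : Finset (Finset V) := univ.filter W with hWset
  -- the cover predicate
  let P : Finset V → Finset (Sym2 V) → Prop := fun B S =>
    ¬ (SimpleGraph.fromEdgeSet ((bobSide B S : Finset (Sym2 V)) : Set (Sym2 V))).Colorable 3 ∨
    ¬ (SimpleGraph.fromEdgeSet ((aliceSide B S : Finset (Sym2 V)) : Set (Sym2 V))).Colorable 3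
  have hcov : ∀ S, μ S ≠ 0 → ∃ B ∈ Wset, P B S := by
    intro S hS
    obtain ⟨B, hB, h⟩ := hrestr S hS
    exact ⟨B, mem_filter.2 ⟨mem_univ _, hB⟩, h⟩
  have hsplit : ∀ B ∈ Wset, ∑ S ∈ univ.filter (P B), μ S ≤ 2 * δ := by
    intro B hB
    have hW : W B := (mem_filter.1 hB).2
    set A₁ : Finset (Finset (Sym2 V)) := univ.filter (fun G =>
      ¬ (SimpleGraph.fromEdgeSet ((bobSide B G : Finset (Sym2 V)) : Set (Sym2 V))).Colorable 3) with hA₁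
    set A₂ : Finset (Finset (Sym2 V)) := univ.filter (fun G =>
      ¬ (SimpleGraph.fromEdgeSet ((aliceSide B G : Finset (Sym2 V)) : Set (Sym2 V))).Colorable 3) with hA₂
    have h1 : ∑ S ∈ A₁, μ S ≤ δ :=
      bobAlone_le_of_rectClause μ hμ hs (hclause B hW) A₁ (fun G hG _ => (mem_filter.1 hG).2)
    have h2 : ∑ S ∈ A₂, μ S ≤ δ :=
      aliceAlone_le_of_rectClause μ hμ hs (hclause B hW) A₂ (fun G hG _ => (mem_filter.1 hG).2)
    have hsub : univ.filter (P B) ⊆ A₁ ∪ A₂ := by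
      intro S hS
      rcases (mem_filter.1 hS).2 with h | h
      · exact mem_union.2 (Or.inl (mem_filter.2 ⟨mem_univ _, h⟩))
      · exact mem_union.2 (Or.inr (mem_filter.2 ⟨mem_univ _, h⟩))
    have hui := sum_union_inter (s₁ := A₁) (s₂ := A₂) (f := μ)
    have hnn : (0 : ℝ) ≤ ∑ S ∈ A₁ ∩ A₂, μ S := sum_nonneg fun S _ => hμ S
    have hle : ∑ S ∈ univ.filter (P B), μ S ≤ ∑ S ∈ A₁ ∪ A₂, μ S :=
      sum_le_sum_of_subset_of_nonneg hsub (fun S _ _ => hμ S)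
    linarith
  calc ∑ S, μ S ≤ ∑ B ∈ Wset, ∑ S ∈ univ.filter (P B), μ S := sum_le_sum_cover Wset P μ hμ hcov
    _ ≤ ∑ _B ∈ Wset, 2 * δ := sum_le_sum hsplit
    _ = (Wset.card : ℝ) * (2 * δ) := by rw [sum_const, nsmul_eq_mul]
    _ ≤ ((2 ^ Fintype.card V : ℕ) : ℝ) * (2 * δ) := by
        have h1 : Wset.card ≤ 2 ^ Fintype.card V := by
          calc Wset.card ≤ (univ : Finset (Finset V)).card := card_le_card (filter_subset _ _)
            _ = 2 ^ Fintype.card V := by rw [card_univ, Fintype.card_finset]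
        exact mul_le_mul_of_nonneg_right (by exact_mod_cast h1) (by linarith)

end General

/-! ### X1 restricted to supports with a non-3-colourable side is false -/

/-- **Non-3-colourable sides cannot be fooled.**  The weakening of the construction space of
`Summit.PneNP.PneNP.Theses.AeaCutRectangles.FoolingMeasure` to measures each of whose support graphs `G` has
SOME cut `B` in X1's window with `G[B]` (the edges inside `B`) or `G ∖ G[B]` (the edges meeting `Fin n ∖ B`)
non-3-colourable makes the statement FALSE: at `C = 2` the `≤ 2·2^n` one-sided rectangles would carry the whole
mass against the threshold `n^{-n/2}·2^{-2n}`.  So a typical X1 support graph has both sides 3-colourable at every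
near-balanced cut. -/
theorem foolingMeasure_false_for_nonColourableSide :
    ¬ ∃ ε : ℝ, 0 < ε ∧ ε ≤ 1 / 4 ∧ ∀ C : ℕ, ∃ᶠ n in Filter.atTop, ∃ μ : Finset (Sym2 (Fin n)) → ℝ,
      (∀ S, 0 ≤ μ S) ∧ (∑ S, μ S = 1) ∧
      (∀ S, μ S ≠ 0 → (∀ e ∈ S, ¬ e.IsDiag) ∧
        ¬ (SimpleGraph.fromEdgeSet (S : Set (Sym2 (Fin n)))).Colorable 3) ∧
      (∀ S, μ S ≠ 0 → ∃ B : Finset (Fin n), (1 / 2 - ε) * (n : ℝ) ≤ B.card ∧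
        (B.card : ℝ) ≤ (1 / 2 + ε) * n ∧
        (¬ (SimpleGraph.fromEdgeSet ((bobSide B S : Finset (Sym2 (Fin n))) : Set (Sym2 (Fin n)))).Colorable 3 ∨
         ¬ (SimpleGraph.fromEdgeSet ((aliceSide B S : Finset (Sym2 (Fin n))) :
            Set (Sym2 (Fin n)))).Colorable 3)) ∧
      ∀ B : Finset (Fin n), (1 / 2 - ε) * (n : ℝ) ≤ B.card → (B.card : ℝ) ≤ (1 / 2 + ε) * n →
        ∀ 𝓐 𝓑 : Finset (Finset (Sym2 (Fin n))),
          (∀ α ∈ 𝓐, ∀ e ∈ α, ¬ e.IsDiag ∧ ∃ v ∈ e, v ∉ B) →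
          (∀ β ∈ 𝓑, ∀ e ∈ β, ¬ e.IsDiag ∧ ∀ v ∈ e, v ∈ B) →
          (∀ α ∈ 𝓐, ∀ β ∈ 𝓑,
            ¬ (SimpleGraph.fromEdgeSet ((α ∪ β : Finset (Sym2 (Fin n))) : Set (Sym2 (Fin n)))).Colorable 3) →
          ∑ q ∈ 𝓐 ×ˢ 𝓑, μ (q.1 ∪ q.2) ≤ (2 : ℝ) ^ (-((n : ℝ) / 2 * Real.logb 2 n) - (C : ℝ) * n) := by
  rintro ⟨ε, hε0, -, hC⟩
  obtain ⟨n, hn4, μ, hμ, hsum, hs, hrestr, hX⟩ := Filter.frequently_atTop.1 (hC 2) 4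
  set δ : ℝ := (2 : ℝ) ^ (-((n : ℝ) / 2 * Real.logb 2 n) - ((2 : ℕ) : ℝ) * n) with hδ
  have hδpos : 0 < δ := Real.rpow_pos_of_pos (by norm_num) _
  have hrestr' : ∀ S, μ S ≠ 0 → ∃ B : Finset (Fin n),
      ((1 / 2 - ε) * (n : ℝ) ≤ B.card ∧ (B.card : ℝ) ≤ (1 / 2 + ε) * n) ∧
      (¬ (SimpleGraph.fromEdgeSet ((bobSide B S : Finset (Sym2 (Fin n))) : Set (Sym2 (Fin n)))).Colorable 3 ∨
       ¬ (SimpleGraph.fromEdgeSet ((aliceSide B S : Finset (Sym2 (Fin n))) :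
          Set (Sym2 (Fin n)))).Colorable 3) := by
    intro S hS
    obtain ⟨B, h1, h2, h⟩ := hrestr S hS
    exact ⟨B, ⟨h1, h2⟩, h⟩
  have htot := total_le_of_oneSided μ hμ hs
    (fun B : Finset (Fin n) => (1 / 2 - ε) * (n : ℝ) ≤ B.card ∧ (B.card : ℝ) ≤ (1 / 2 + ε) * n)
    hδpos.le (fun B hB => hX B hB.1 hB.2) hrestr'
  rw [hsum, Fintype.card_fin] at htot
  -- 2^n · 2 · δ = 2 · 2^{-n} · n^{-n/2} ≤ 2 · 2^{-n} < 1
  have hn1 : (1 : ℝ) ≤ n := by exact_mod_cast (show 1 ≤ n by omega)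
  have hA : (1 : ℝ) ≤ (n : ℝ) ^ ((n : ℝ) / 2) := Real.one_le_rpow hn1 (by positivity)
  have hsplit : δ = ((n : ℝ) ^ ((n : ℝ) / 2))⁻¹ * (((2 : ℝ) ^ n)⁻¹ * ((2 : ℝ) ^ n)⁻¹) := by
    rw [hδ, Real.rpow_sub (by norm_num), Real.rpow_neg (by norm_num), two_rpow_half_logb (by omega),
      div_eq_mul_inv]
    congr 1
    rw [show ((2 : ℕ) : ℝ) * (n : ℝ) = ((n + n : ℕ) : ℝ) by push_cast; ring, Real.rpow_natCast, pow_add,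
      mul_inv]
  have h2n : (0 : ℝ) < (2 : ℝ) ^ n := by positivity
  have h4 : (4 : ℝ) ≤ (2 : ℝ) ^ n := by
    calc (4 : ℝ) = 2 ^ 2 := by norm_num
      _ ≤ 2 ^ n := pow_le_pow_right₀ (by norm_num) (by omega)
  have key : ((2 ^ n : ℕ) : ℝ) * (2 * δ) ≤ 2 / (2 : ℝ) ^ n := by
    rw [hsplit]
    push_cast
    have hA' : ((n : ℝ) ^ ((n : ℝ) / 2))⁻¹ ≤ 1 := inv_le_one_of_one_le₀ hA
    have hpos : (0 : ℝ) ≤ ((2 : ℝ) ^ n)⁻¹ * ((2 : ℝ) ^ n)⁻¹ := by positivity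
    calc (2 : ℝ) ^ n * (2 * (((n : ℝ) ^ ((n : ℝ) / 2))⁻¹ * (((2 : ℝ) ^ n)⁻¹ * ((2 : ℝ) ^ n)⁻¹)))
        ≤ (2 : ℝ) ^ n * (2 * (1 * (((2 : ℝ) ^ n)⁻¹ * ((2 : ℝ) ^ n)⁻¹))) := by gcongr
      _ = 2 / (2 : ℝ) ^ n := by field_simp
  have hlt : 2 / (2 : ℝ) ^ n < 1 := by
    rw [div_lt_one h2n]; linarith
  linarith

end Summit.PneNP.PneNP.Theorems.AeaCutRectanglesOneSided
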